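import Mathlib.LinearAlgebra.SymplecticGroup
import Mathlib.LinearAlgebra.Matrix.GeneralLinearGroup.Defs
import Mathlib.Tactic.Group
import Batteries.Tactic.OpenPrivate
import HarnessLib

/-!
# Generation of the symplectic group by the Siegel parabolic and the Weyl element

For a commutative LOCAL ring `R` (in particular any field) and a finite index type `l`, the matrix
symplectic group `Sp_{2l}(R) = Matrix.symplecticGroup l R` (Mathlib: `A * J * Aᵀ = J`,
`J = fromBlocks 0 (-1) 1 0`) is GENERATED by

* the Levi factor of the Siegel parabolic, `m(a) = fromBlocks a 0 0 a⁻ᵀ`, `a ∈ GL_l(R)`;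
* its unipotent radical, `n(b) = fromBlocks 1 b 0 1`, `b` symmetric;
* the Weyl element `J` (Mathlib's `SymplecticGroup.symJ`).

This is the classical statement `Sp(W) = ⟨P, w⟩` (`P = M N` the stabiliser of the Lagrangian `X ⊕ 0`)
used throughout the theory of the Weil representation: an implementer / a splitting / a cocycle identity
checked on `m(a)`, `n(b)` and `w` determines it on the whole group [Weil 1964, Chap. I n° 3–5 and the
normalisation of `r` on these generators in n° 13; Moeglin–Vignéras–Waldspurger, Chap. 2, II.2–II.6;
Kudla's splitting is likewise given on `P × {w}`].

## Proof

Pure block algebra on top of ONE lemma that Mathlib already proves (privately, inside its proof of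
`SymplecticGroup.det_eq_one`, accessed here with `open private`): for a symplectic `fromBlocks A B C D` over a
local ring there is a symmetric `X` with `A + X C` invertible
(`SymplecticGroup.exists_symmetric_X_isUnit_det_add_mul_of_symplectic`). Then `n(X) g` has invertible upper-left
block `a`, `c := C a⁻¹` is symmetric by the first symplectic block relation, `v(-c) n(X) g` is block upper
triangular with `v(c) = fromBlocks 1 0 c 1 = J n(-c) J⁻¹`, and `m(a)⁻¹ v(-c) n(X) g = fromBlocks 1 b 0 d` is
symplectic, which forces `d = 1` and `b` symmetric, i.e. it IS `n(b)`. Hence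
`g = n(X)⁻¹ v(c) m(a) n(b) ∈ ⟨m, n, J⟩` — the big-cell (Bruhat) decomposition `Sp = N · (N⁻ M N)` made explicit.

## Main results

* `SymplecticMatrix.levi`, `SymplecticMatrix.unip`, `SymplecticMatrix.low` — the elements `m(a)`, `n(b)`, `v(c)` of
  `Matrix.symplecticGroup l R`, with their block relations (`levi_mul`, `unip_add`, `low_mul_J`, …);
* `SymplecticMatrix.mem_of_isUnit_toBlocks₁₁` — the big cell lies in any subgroup containing `m`, `n`, `v`;
* **`SymplecticMatrix.closure_levi_unip_J_eq_top`** — `Subgroup.closure (m(GL) ∪ n(Sym) ∪ {J}) = ⊤`;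
* `SymplecticMatrix.eq_top_of_generators_mem`, `SymplecticMatrix.hom_ext` — the two consumable forms
  (a subgroup containing the generators is everything; two homomorphisms agreeing on the generators agree).

All statements are kernel-checked; nothing is cited as a hypothesis.
-/

open Matrix

open private exists_symmetric_X_isUnit_det_add_mul_of_symplectic from Mathlib.LinearAlgebra.SymplecticGroup

namespace Literature.RepresentationTheory.HeisenbergGroup.SymplecticMatrix

variable {l R : Type*} [DecidableEq l] [Fintype l] [CommRing R]

/-! ## §1. The generators as elements of `Matrix.symplecticGroup l R` -/

/-- **The Levi element `m(a) = diag(a, a⁻ᵀ)`** of the Siegel parabolic, `a ∈ GL_l(R)`.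
[cite: MoeglinVignerasWaldspurger1987, Chap. 2 II.2] -/
def levi (a : GL l R) : Matrix.symplecticGroup l R :=
  ⟨fromBlocks (a : Matrix l l R) 0 0 ((a⁻¹ : GL l R) : Matrix l l R)ᵀ, by
    rw [SymplecticGroup.fromBlocks_mem_iff]
    refine ⟨by simp, by simp, ?_⟩
    rw [transpose_zero, zero_mul, sub_zero, ← transpose_mul, ← Units.val_mul, inv_mul_cancel, Units.val_one,
      transpose_one]⟩

/-- The matrix of `m(a)`. [folklore] -/
@[simp] theorem coe_levi (a : GL l R) :
    ((levi a : Matrix.symplecticGroup l R) : Matrix (l ⊕ l) (l ⊕ l) R) =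
      fromBlocks (a : Matrix l l R) 0 0 ((a⁻¹ : GL l R) : Matrix l l R)ᵀ := rfl

/-- **The unipotent element `n(b) = fromBlocks 1 b 0 1`** of the Siegel parabolic, `b` symmetric.
[cite: MoeglinVignerasWaldspurger1987, Chap. 2 II.2] -/
def unip (b : Matrix l l R) (hb : b.IsSymm) : Matrix.symplecticGroup l R :=
  ⟨fromBlocks 1 b 0 1, by
    rw [SymplecticGroup.fromBlocks_mem_iff]
    refine ⟨by simp, by simpa using hb.eq, by simp⟩⟩

/-- The matrix of `n(b)`. [folklore] -/
@[simp] theorem coe_unip (b : Matrix l l R) (hb : b.IsSymm) :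
    ((unip b hb : Matrix.symplecticGroup l R) : Matrix (l ⊕ l) (l ⊕ l) R) = fromBlocks 1 b 0 1 := rfl

/-- **The opposite unipotent element `v(c) = fromBlocks 1 0 c 1`**, `c` symmetric (the unipotent radical of the
opposite Siegel parabolic; `v(c) = J n(-c) J⁻¹`, `low_eq_conj`). [folklore] -/
def low (c : Matrix l l R) (hc : c.IsSymm) : Matrix.symplecticGroup l R :=
  ⟨fromBlocks 1 0 c 1, by
    rw [SymplecticGroup.fromBlocks_mem_iff]
    refine ⟨by simpa using hc.eq.symm, by simp, by simp⟩⟩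

/-- The matrix of `v(c)`. [folklore] -/
@[simp] theorem coe_low (c : Matrix l l R) (hc : c.IsSymm) :
    ((low c hc : Matrix.symplecticGroup l R) : Matrix (l ⊕ l) (l ⊕ l) R) = fromBlocks 1 0 c 1 := rfl

/-- `m(1) = 1`. [folklore] -/
@[simp] theorem levi_one : (levi 1 : Matrix.symplecticGroup l R) = 1 := by
  apply Subtype.ext
  simp [fromBlocks_one]

/-- `m(a a') = m(a) m(a')` — `m` is a homomorphism `GL_l(R) → Sp_{2l}(R)`. [folklore] -/
theorem levi_mul (a a' : GL l R) : (levi (a * a') : Matrix.symplecticGroup l R) = levi a * levi a' := by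
  apply Subtype.ext
  simp only [coe_levi, Submonoid.coe_mul, fromBlocks_multiply, Matrix.mul_zero, Matrix.zero_mul, add_zero,
    zero_add, _root_.mul_inv_rev, Units.val_mul, transpose_mul]

/-- **`m : GL_l(R) →* Sp_{2l}(R)`** as a monoid homomorphism. [folklore] -/
def leviHom : GL l R →* Matrix.symplecticGroup l R where
  toFun := levi
  map_one' := levi_one
  map_mul' := levi_mul

/-- Unfolding of `leviHom`. [folklore] -/
@[simp] theorem leviHom_apply (a : GL l R) : leviHom a = (levi a : Matrix.symplecticGroup l R) := rfl

/-- `n(0) = 1`. [folklore] -/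
@[simp] theorem unip_zero : (unip 0 isSymm_zero : Matrix.symplecticGroup l R) = 1 := by
  apply Subtype.ext
  simp [fromBlocks_one]

/-- `n(b + b') = n(b) n(b')` — `n` is additive. [folklore] -/
theorem unip_add (b b' : Matrix l l R) (hb : b.IsSymm) (hb' : b'.IsSymm) :
    (unip (b + b') (hb.add hb') : Matrix.symplecticGroup l R) = unip b hb * unip b' hb' := by
  apply Subtype.ext
  simp only [coe_unip, Submonoid.coe_mul, fromBlocks_multiply, Matrix.mul_zero, Matrix.zero_mul, Matrix.one_mul,
    Matrix.mul_one, add_zero, zero_add, add_comm b b']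

/-- `n(-b) = n(b)⁻¹`. [folklore] -/
theorem unip_neg (b : Matrix l l R) (hb : b.IsSymm) :
    (unip (-b) hb.neg : Matrix.symplecticGroup l R) = (unip b hb)⁻¹ := by
  rw [eq_inv_iff_mul_eq_one, ← unip_add]
  convert unip_zero (l := l) (R := R) using 2
  exact neg_add_cancel b

/-- `m(a) n(b) m(a)⁻¹ = n(a b aᵀ)` — the Levi factor normalises the unipotent radical. [folklore] -/
theorem levi_mul_unip_mul_levi_inv (a : GL l R) (b : Matrix l l R) (hb : b.IsSymm) :
    (levi a * unip b hb * (levi a)⁻¹ : Matrix.symplecticGroup l R) =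
      unip ((a : Matrix l l R) * b * (a : Matrix l l R)ᵀ) (by
        change ((a : Matrix l l R) * b * (a : Matrix l l R)ᵀ)ᵀ = _
        rw [transpose_mul, transpose_mul, transpose_transpose, hb.eq, Matrix.mul_assoc]) := by
  rw [mul_inv_eq_iff_eq_mul]
  apply Subtype.ext
  simp only [coe_levi, coe_unip, Submonoid.coe_mul, fromBlocks_multiply, Matrix.mul_zero, Matrix.zero_mul,
    Matrix.mul_one, Matrix.one_mul, add_zero, zero_add, Matrix.mul_assoc, ← transpose_mul, ← Units.val_mul,
    inv_mul_cancel, Units.val_one, transpose_one]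

/-- **`v(c) J = J n(-c)`**: the opposite unipotent is the `J`-conjugate of the unipotent radical. [folklore] -/
theorem low_mul_J (c : Matrix l l R) (hc : c.IsSymm) :
    (low c hc * SymplecticGroup.symJ l R : Matrix.symplecticGroup l R) = SymplecticGroup.symJ l R * unip (-c) hc.neg := by
  apply Subtype.ext
  simp only [coe_low, coe_unip, Submonoid.coe_mul, SymplecticGroup.coe_J, Matrix.J, fromBlocks_multiply,
    Matrix.mul_zero, Matrix.zero_mul, Matrix.one_mul, add_zero, zero_add, Matrix.mul_neg, mul_one, neg_zero]

/-- `v(c) = J n(-c) J⁻¹`. [folklore] -/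
theorem low_eq_conj (c : Matrix l l R) (hc : c.IsSymm) :
    (low c hc : Matrix.symplecticGroup l R) =
      SymplecticGroup.symJ l R * unip (-c) hc.neg * (SymplecticGroup.symJ l R)⁻¹ := by
  rw [eq_mul_inv_iff_mul_eq, low_mul_J]

/-- **`J n(b) = v(-b) J`** (the same conjugation read the other way). [folklore] -/
theorem J_mul_unip (b : Matrix l l R) (hb : b.IsSymm) :
    (SymplecticGroup.symJ l R * unip b hb : Matrix.symplecticGroup l R) = low (-b) hb.neg * SymplecticGroup.symJ l R := by
  apply Subtype.ext
  simp only [coe_low, coe_unip, Submonoid.coe_mul, SymplecticGroup.coe_J, Matrix.J, fromBlocks_multiply,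
    Matrix.mul_zero, Matrix.zero_mul, Matrix.one_mul, add_zero, zero_add, mul_neg, mul_one, neg_neg]

/-- `n(b) = J⁻¹ v(-b) J`. [folklore] -/
theorem unip_eq_conj (b : Matrix l l R) (hb : b.IsSymm) :
    (unip b hb : Matrix.symplecticGroup l R) =
      (SymplecticGroup.symJ l R)⁻¹ * (low (-b) hb.neg * SymplecticGroup.symJ l R) := by
  rw [eq_inv_mul_iff_mul_eq, J_mul_unip]

/-- A subgroup containing `J` and every `v(c)` contains every `n(b)` (so `⟨m, v, J⟩ = ⟨m, n, J⟩`; the tree's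
coordinate-free `unipotentSp β b : (x, y) ↦ (x, y + b x)` is a `v`). [folklore] -/
theorem unip_mem {H : Subgroup (Matrix.symplecticGroup l R)} (hJ : SymplecticGroup.symJ l R ∈ H)
    (hv : ∀ (c : Matrix l l R) (hc : c.IsSymm), low c hc ∈ H) (b : Matrix l l R) (hb : b.IsSymm) :
    unip b hb ∈ H := by
  rw [unip_eq_conj]
  exact H.mul_mem (H.inv_mem hJ) (H.mul_mem (hv _ _) hJ)

/-- A subgroup containing `J` and every `n(b)` contains every `v(c)`. [folklore] -/
theorem low_mem {H : Subgroup (Matrix.symplecticGroup l R)} (hJ : SymplecticGroup.symJ l R ∈ H)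
    (hn : ∀ (b : Matrix l l R) (hb : b.IsSymm), unip b hb ∈ H) (c : Matrix l l R) (hc : c.IsSymm) :
    low c hc ∈ H := by
  rw [low_eq_conj]
  exact H.mul_mem (H.mul_mem hJ (hn _ _)) (H.inv_mem hJ)

/-! ## §2. The big cell -/

/-- **The big cell lies in `⟨m, n, v⟩`.** If the upper-left block `a` of `g ∈ Sp_{2l}(R)` is invertible then
`g = v(c) m(a) n(b)` with `c = C a⁻¹` and `b = a⁻¹ B` (both symmetric by the symplectic block relations), so `g`
lies in every subgroup containing the `m(a)`, `n(b)`, `v(c)`. [cite: MoeglinVignerasWaldspurger1987, Chap. 2 II.5] -/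
theorem mem_of_isUnit_toBlocks₁₁ {H : Subgroup (Matrix.symplecticGroup l R)} (hm : ∀ a : GL l R, levi a ∈ H)
    (hn : ∀ (b : Matrix l l R) (hb : b.IsSymm), unip b hb ∈ H)
    (hv : ∀ (c : Matrix l l R) (hc : c.IsSymm), low c hc ∈ H) (g : Matrix.symplecticGroup l R)
    (hA : IsUnit (g : Matrix (l ⊕ l) (l ⊕ l) R).toBlocks₁₁) : g ∈ H := by
  obtain ⟨a, ha⟩ := hA
  set B := (g : Matrix (l ⊕ l) (l ⊕ l) R).toBlocks₁₂ with hB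
  set C := (g : Matrix (l ⊕ l) (l ⊕ l) R).toBlocks₂₁ with hC
  set D := (g : Matrix (l ⊕ l) (l ⊕ l) R).toBlocks₂₂ with hD
  have hg : (g : Matrix (l ⊕ l) (l ⊕ l) R) = fromBlocks (a : Matrix l l R) B C D := by
    rw [ha]; exact (fromBlocks_toBlocks _).symm
  obtain ⟨h1, -, -⟩ := SymplecticGroup.fromBlocks_mem_iff.1 (hg ▸ g.2)
  -- `c := C a⁻¹` is symmetric: from `aᵀ C = Cᵀ a`.
  set c : Matrix l l R := C * ((a⁻¹ : GL l R) : Matrix l l R) with hc_def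
  have hai : (a : Matrix l l R) * ((a⁻¹ : GL l R) : Matrix l l R) = 1 := by
    rw [← Units.val_mul, mul_inv_cancel, Units.val_one]
  have hia : ((a⁻¹ : GL l R) : Matrix l l R) * (a : Matrix l l R) = 1 := by
    rw [← Units.val_mul, inv_mul_cancel, Units.val_one]
  have hc : c.IsSymm := by
    change (C * ((a⁻¹ : GL l R) : Matrix l l R))ᵀ = C * ((a⁻¹ : GL l R) : Matrix l l R)
    have key : ((a⁻¹ : GL l R) : Matrix l l R)ᵀ * ((a : Matrix l l R)ᵀ * C) * ((a⁻¹ : GL l R) : Matrix l l R) =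
        ((a⁻¹ : GL l R) : Matrix l l R)ᵀ * (Cᵀ * (a : Matrix l l R)) * ((a⁻¹ : GL l R) : Matrix l l R) := by
      rw [h1]
    rw [← Matrix.mul_assoc, ← transpose_mul, hai, transpose_one, Matrix.one_mul, Matrix.mul_assoc,
      Matrix.mul_assoc, hai, Matrix.mul_one] at key
    rw [transpose_mul, key]
  -- `v(-c) g` is block upper triangular
  have e1 : ((low (-c) hc.neg * g : Matrix.symplecticGroup l R) : Matrix (l ⊕ l) (l ⊕ l) R) =
      fromBlocks (a : Matrix l l R) B 0 (D - c * B) := by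
    rw [Submonoid.coe_mul, hg, coe_low, fromBlocks_multiply]
    congr 1
    · rw [Matrix.one_mul, Matrix.zero_mul, add_zero]
    · rw [Matrix.one_mul, Matrix.zero_mul, add_zero]
    · rw [Matrix.one_mul, hc_def, Matrix.neg_mul, Matrix.mul_assoc, hia, Matrix.mul_one, neg_add_cancel]
    · rw [Matrix.one_mul, Matrix.neg_mul, neg_add_eq_sub]
  -- `m(a)⁻¹ v(-c) g = fromBlocks 1 b 0 d`
  have e2 : ((levi a⁻¹ * (low (-c) hc.neg * g) : Matrix.symplecticGroup l R) : Matrix (l ⊕ l) (l ⊕ l) R) =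
      fromBlocks 1 (((a⁻¹ : GL l R) : Matrix l l R) * B) 0 ((a : Matrix l l R)ᵀ * (D - c * B)) := by
    rw [Submonoid.coe_mul, e1, coe_levi, inv_inv, fromBlocks_multiply]
    congr 1
    · rw [Matrix.zero_mul, add_zero, hia]
    · rw [Matrix.zero_mul, add_zero]
    · rw [Matrix.zero_mul, Matrix.mul_zero, add_zero]
    · rw [Matrix.zero_mul, zero_add]
  -- which is symplectic, hence `d = 1` and `b` symmetric
  obtain ⟨-, k2, k3⟩ := SymplecticGroup.fromBlocks_mem_iff.1 (e2 ▸ (levi a⁻¹ * (low (-c) hc.neg * g)).2)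
  rw [transpose_one, Matrix.one_mul, transpose_zero, Matrix.zero_mul, sub_zero] at k3
  rw [k3, Matrix.mul_one, transpose_one, Matrix.one_mul] at k2
  have e3 : levi a⁻¹ * (low (-c) hc.neg * g) = unip (((a⁻¹ : GL l R) : Matrix l l R) * B) k2 := by
    apply Subtype.ext
    rw [e2, coe_unip, k3]
  have e4 : g = (low (-c) hc.neg)⁻¹ * ((levi a⁻¹)⁻¹ * (levi a⁻¹ * (low (-c) hc.neg * g))) := by group
  rw [e4, e3]
  exact H.mul_mem (H.inv_mem (hv _ _)) (H.mul_mem (H.inv_mem (hm _)) (hn _ _))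

/-! ## §3. Generation -/

/-- The generating set `m(GL_l(R)) ∪ n(Sym_l(R)) ∪ {J}` of `Sp_{2l}(R)`. [folklore] -/
def generators (l R : Type*) [DecidableEq l] [Fintype l] [CommRing R] : Set (Matrix.symplecticGroup l R) :=
  Set.range (levi : GL l R → Matrix.symplecticGroup l R) ∪
    {g | ∃ (b : Matrix l l R) (hb : b.IsSymm), unip b hb = g} ∪ {SymplecticGroup.symJ l R}

/-- `m(a)` is a generator. [folklore] -/
theorem levi_mem_generators (a : GL l R) : levi a ∈ generators l R := Or.inl (Or.inl ⟨a, rfl⟩)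

/-- `n(b)` is a generator. [folklore] -/
theorem unip_mem_generators (b : Matrix l l R) (hb : b.IsSymm) : unip b hb ∈ generators l R :=
  Or.inl (Or.inr ⟨b, hb, rfl⟩)

/-- `J` is a generator. [folklore] -/
theorem J_mem_generators : SymplecticGroup.symJ l R ∈ generators l R := Or.inr rfl

/-- **A subgroup of `Sp_{2l}(R)` (`R` local, e.g. a field) containing every `m(a)`, every `n(b)` and `J` is the
whole group.** Proof: for `g = fromBlocks A B C D` symplectic, Mathlib's (private) lemma
`SymplecticGroup.exists_symmetric_X_isUnit_det_add_mul_of_symplectic` gives a symmetric `X` with `A + X C`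
invertible; `n(X) g` then lies in the big cell (`mem_of_isUnit_toBlocks₁₁`, with `v(c) = J n(-c) J⁻¹`).
[cite: MoeglinVignerasWaldspurger1987, Chap. 2 II.5] -/
theorem eq_top_of_generators_mem [IsLocalRing R] {H : Subgroup (Matrix.symplecticGroup l R)}
    (hm : ∀ a : GL l R, levi a ∈ H) (hn : ∀ (b : Matrix l l R) (hb : b.IsSymm), unip b hb ∈ H)
    (hJ : SymplecticGroup.symJ l R ∈ H) : H = ⊤ := by
  rw [eq_top_iff]
  rintro g -
  set A := (g : Matrix (l ⊕ l) (l ⊕ l) R).toBlocks₁₁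
  set B := (g : Matrix (l ⊕ l) (l ⊕ l) R).toBlocks₁₂
  set C := (g : Matrix (l ⊕ l) (l ⊕ l) R).toBlocks₂₁
  set D := (g : Matrix (l ⊕ l) (l ⊕ l) R).toBlocks₂₂
  have hg : (g : Matrix (l ⊕ l) (l ⊕ l) R) = fromBlocks A B C D := (fromBlocks_toBlocks _).symm
  obtain ⟨X, hX, hdet⟩ := exists_symmetric_X_isUnit_det_add_mul_of_symplectic (hg ▸ g.2)
  have hblk : ((unip X hX * g : Matrix.symplecticGroup l R) : Matrix (l ⊕ l) (l ⊕ l) R).toBlocks₁₁ = A + X * C := by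
    rw [Submonoid.coe_mul, hg, coe_unip, fromBlocks_multiply, toBlocks_fromBlocks₁₁, Matrix.one_mul]
  have hmem : unip X hX * g ∈ H :=
    mem_of_isUnit_toBlocks₁₁ hm hn (low_mem hJ hn) _ (by
      rw [hblk]; exact (Matrix.isUnit_iff_isUnit_det _).2 hdet)
  rw [← inv_mul_cancel_left (unip X hX) g]
  exact H.mul_mem (H.inv_mem (hn X hX)) hmem

/-- The same with the OPPOSITE unipotents: a subgroup containing every `m(a)`, every `v(c) = fromBlocks 1 0 c 1` and
`J` is everything (`R` local). [cite: MoeglinVignerasWaldspurger1987, Chap. 2 II.5] -/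
theorem eq_top_of_generators_mem' [IsLocalRing R] {H : Subgroup (Matrix.symplecticGroup l R)}
    (hm : ∀ a : GL l R, levi a ∈ H) (hv : ∀ (c : Matrix l l R) (hc : c.IsSymm), low c hc ∈ H)
    (hJ : SymplecticGroup.symJ l R ∈ H) : H = ⊤ :=
  eq_top_of_generators_mem hm (unip_mem hJ hv) hJ

/-- **`Sp_{2l}(R) = ⟨m(GL_l(R)), n(Sym_l(R)), J⟩`** for a local ring `R` (in particular a field): the symplectic
group is generated by the Siegel parabolic `P = M N` and the Weyl element.
[cite: MoeglinVignerasWaldspurger1987, Chap. 2 II.5] -/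
theorem closure_generators_eq_top [IsLocalRing R] : Subgroup.closure (generators l R) = ⊤ :=
  eq_top_of_generators_mem (fun a => Subgroup.subset_closure (levi_mem_generators a))
    (fun b hb => Subgroup.subset_closure (unip_mem_generators b hb))
    (Subgroup.subset_closure J_mem_generators)

/-- Every `g ∈ Sp_{2l}(R)` lies in the subgroup generated by the `m(a)`, `n(b)` and `J`. [folklore] -/
theorem mem_closure_generators [IsLocalRing R] (g : Matrix.symplecticGroup l R) :
    g ∈ Subgroup.closure (generators l R) := by
  rw [closure_generators_eq_top]; exact Subgroup.mem_top g

/-- **Two homomorphisms out of `Sp_{2l}(R)` that agree on every `m(a)`, every `n(b)` and on `J` are equal**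
(`R` local) — the form in which generation is consumed by splittings / implementer identities. [folklore] -/
theorem hom_ext [IsLocalRing R] {G : Type*} [Group G] {φ ψ : Matrix.symplecticGroup l R →* G}
    (hm : ∀ a : GL l R, φ (levi a) = ψ (levi a))
    (hn : ∀ (b : Matrix l l R) (hb : b.IsSymm), φ (unip b hb) = ψ (unip b hb))
    (hJ : φ (SymplecticGroup.symJ l R) = ψ (SymplecticGroup.symJ l R)) : φ = ψ := by
  refine MonoidHom.eq_of_eqOn_dense (closure_generators_eq_top (l := l) (R := R)) ?_
  rintro g ((⟨a, rfl⟩ | ⟨b, hb, rfl⟩) | rfl)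
  · exact hm a
  · exact hn b hb
  · exact hJ

/-- The image of a homomorphism `f : Sp_{2l}(R) →* G` (`R` local) lies in a subgroup `K ≤ G` as soon as the
images of the generators do — e.g. `K` = the Θ-liftable subgroup of an adelic symplectic group and `f` = the
inclusion of the rational points. [folklore] -/
theorem range_le_of_generators_mem [IsLocalRing R] {G : Type*} [Group G] (f : Matrix.symplecticGroup l R →* G)
    {K : Subgroup G} (hm : ∀ a : GL l R, f (levi a) ∈ K)
    (hn : ∀ (b : Matrix l l R) (hb : b.IsSymm), f (unip b hb) ∈ K)
    (hJ : f (SymplecticGroup.symJ l R) ∈ K) : f.range ≤ K := by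
  rw [MonoidHom.range_eq_map, ← closure_generators_eq_top, MonoidHom.map_closure, Subgroup.closure_le]
  rintro _ ⟨g, ((⟨a, rfl⟩ | ⟨b, hb, rfl⟩) | rfl), rfl⟩
  · exact hm a
  · exact hn b hb
  · exact hJ

end Literature.RepresentationTheory.HeisenbergGroup.SymplecticMatrix
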